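import Literature.AnabelianGeometry.AbsoluteAnabelian.AbsTopIII.Thm19DictionaryBridgeValues
import Literature.AnabelianGeometry.AbsoluteAnabelian.AbsTopIII.Thm19KummerContainerEmbeddingPinned
import Literature.AnabelianGeometry.AbsoluteAnabelian.AbsTopIII.Thm19eSatProofs
import Literature.AnabelianGeometry.AbsoluteAnabelian.AbsTopIII.Thm19TaggedStatements
import Literature.NumberTheory.DiophantineGeometry.FunctionFieldDivisorsLinearEquivalenceProofs
import HarnessLib

/-!
# [AbsTopIII] Thm. 1.9 (e) at every law-abiding model: `Thm19eSat` for saturated tagged systems, DERIVED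
# from the per-curve laws (proof-only; assembly of the (e)-bridge)

Mochizuki, *Topics in Absolute Anabelian Geometry III*, §1, Theorem 1.9 (e), manuscript p. 38 (lit key
`paper:url-5493eb38cbb7`): "One constructs the additive structure on `k̄_NF^× ∪ {0}`; `K_{Z_NF}^× ∪ {0}`
[...] by applying the functorial algorithm of Proposition 1.3 to the data [...] arising from the
construction of (d)".

Cell abc-iut, sub-DAG `plan/L4/SUBDAG-AbsTopIII-Thm19.md`, row Thm19.e.r11 (statement of record
`IntrinsicKummerModel.Thm19eSat`); abc-iut-L4-lead RULING #5j (3).  ASSEMBLY of the (e)-bridge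
(`Thm19DictionaryBridgePoints` / `…Orders` / `…Values`): for a `PlacedKummerModelV2` (the six-layer law
tower: abc-iut-L4-t1 layers I–IV, abc-iut-w5-d213 layers V–VI) every SATURATED directed system of
NF-complements over a (d)-input that carries geometric tags (`GeomTags`) admits the full levelwise
dictionary of `thm19eSat_of_dictionary` — (e0) `K_{Z_NF}/k̄_NF` is an algebraic function field of genus
`g(Z) ≥ 2` (layer III); the pinned Kummer embedding `e` of "`K_{Z_NF}^×`" (abc-iut-w5-d213's
`exists_functionFieldEmbedding_kummer`, composed with inversion when the orientation sign `degSign` of law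
(D) is `−1`); (e1) the point dictionary; (e2) orders; (e3) values — hence
`PlacedKummerModelV2.thm19eSat_of_tags : … → N.Thm19eSat`, modulo abc-iut-L4-t1's named facts
`Prop_1_8_i/ii`, `Prop_1_6_i`, `Prop_1_6_iii_units/ker`, `Prop_1_4_i/i′/ii/ii_transgression` and
`Rmk_1_5_4_i` BY NAME.  Row r11 thereby joins rows r8–r10: PROVED AT EVERY LAW-ABIDING MODEL for tagged
systems.  All theorems; no definition, no new named fact; nothing here bears on [IUTchIII] Cor. 3.12.
-/

noncomputable section

open CategoryTheory
open scoped Pointwise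

namespace Literature.AnabelianGeometry.AbsoluteAnabelian.AbsTopIII

open Literature.NumberTheory.DiophantineGeometry
open Literature.NumberTheory.DiophantineGeometry.AlgFunctionField

universe u

namespace PlacedKummerModelV2

variable (N : PlacedKummerModelV2.{u}) {Z : N.Curve} {ι : Type u} [Preorder ι]
  (S : CurveModel.NFComplementSystem N.toCurveModel Z ι)

/-- The inverse of a representative represents the inverse.
[cite: MochizukiAbsTopIII2015, Thm 1.9 (d) p.37] -/
theorem rep_inv (T : CurveModel.NFComplementSystem.GeomTags N.toDescentKummerModel S) {j : ι}
    (g : N.regularUnits (S.V j)) (u : (N.NFFunctionField Z)ˣ)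
    (hrep : letI := N.instGeomField Z;
      N.toGeom (T.hZb j) ((N.fieldRes (S.isOpen j)).symm ((g : (N.FunctionField (S.V j))ˣ) : _)) =
        N.nfToGeom Z (u : N.NFFunctionField Z)) :
    letI := N.instGeomField Z;
      N.toGeom (T.hZb j) ((N.fieldRes (S.isOpen j)).symm ((g⁻¹ : (N.FunctionField (S.V j))ˣ) : _)) =
        N.nfToGeom Z ((u⁻¹ : (N.NFFunctionField Z)ˣ) : N.NFFunctionField Z) := by
  letI := N.instGeomField Z
  simp only [Units.val_inv_eq_inv_val, map_inv₀]
  rw [hrep]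

/-- **The levelwise dictionary of a saturated tagged system** (the hypothesis of
`thm19eSat_of_dictionary` for ONE system), derived from the laws.
[cite: MochizukiAbsTopIII2015, Thm 1.9 (e) p.38] -/
theorem exists_dictionary (T : CurveModel.NFComplementSystem.GeomTags N.toDescentKummerModel S) [Nonempty ι] [IsDirectedOrder ι] (h18i : N.Prop_1_8_i) (h18ii : N.Prop_1_8_ii)
    (h16u : N.Prop_1_6_iii_units) (h16k : N.Prop_1_6_iii_ker) (h16 : N.Prop_1_6_i)
    (h154 : Rmk_1_5_4_i.{u}) (h14i : N.Prop_1_4_i) (h14 : N.Prop_1_4_i') (h142 : N.Prop_1_4_ii)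
    (hT14 : N.Prop_1_4_ii_transgression) (hZ : N.IsThm19dInput Z) (hS : N.IsSaturated S) :
    ∃ (_ : Algebra ↥(N.kbarNF Z) (N.NFFunctionField Z))
      (_ : IsAlgFunctionField ↥(N.kbarNF Z) (N.NFFunctionField Z)),
      2 ≤ genus ↥(N.kbarNF Z) (N.NFFunctionField Z) ∧
      ∃ (e : Additive (N.NFFunctionField Z)ˣ →+ S.kummerContainer)
        (π : N.NFPointIndex S → PlaceOver ↥(N.kbarNF Z) (N.NFFunctionField Z)),
        Function.Injective e ∧ Set.range e = N.functionFieldPart S ∧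
        (∀ a b, N.SamePoint S a b ↔ π a = π b) ∧ Function.Surjective π ∧
        (∀ (f : (N.NFFunctionField Z)ˣ) (a : N.NFPointIndex S) (n : ℤ),
          N.HasOrderAt S (e (Additive.ofMul f)) a n ↔ (π a).ord (f : N.NFFunctionField Z) = n) ∧
        (∀ (f : (N.NFFunctionField Z)ˣ) (a : N.NFPointIndex S),
          N.HasValueOneAt S (e (Additive.ofMul f)) a ↔ f ∈ unitsWithValueOne (π a)) := by
  letI := N.instGeomField Z
  letI := N.nfAlgebra Z
  refine ⟨N.nfAlgebra Z, N.nf_isAlgFunctionField Z hZ.isNFCurve hZ.isScheme, ?_, ?_⟩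
  · rw [N.nf_genus Z hZ.isNFCurve hZ.isScheme]
    exact hZ.two_le_genus
  -- the tower and the pinned embedding
  obtain ⟨Ω', _, ⟨T'⟩⟩ := N.exists_nfTower_of_tags S T hZ.isNFCurve
  have hinjS : ∀ i : ι, Function.Injective (N.kummerToContainer S i) :=
    T'.kummerToContainer_injective hZ h16 h154
  have hparts : N.functionFieldPart S = N.nfRationalImage S :=
    T'.functionFieldPart_eq_nfRationalImage h18i h18ii h16u h16k h154 hZ
  obtain ⟨E, hEinj, hErange, hEpin⟩ := N.exists_functionFieldEmbedding_kummer S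
    (fun i j h => (N.unitRes (T.hVW h)).comp (N.bcUnitRes (T.hWV h)))
    (fun i j h f => N.transition_kummerLevel S T (Additive.toMul f) h)
    (N.geomField Z) (fun i => (N.toGeom (T.hZb i)).comp (N.fieldRes (S.isOpen i)).symm.toRingHom)
    (fun i j h f => N.toGeom_fieldRes_coherent (T.hVW h) (T.hWZ h) (S.isOpen j) (T.hWV h) (T.hZZ h)
      (S.isOpen i) (T.hZb i) (T.hZb j) ((f : (N.FunctionField (S.V i))ˣ) : N.FunctionField (S.V i)))
    (N.nfToGeom Z)
    (fun i g => N.isNFRational_iff_toGeom_mem (S.isOpen i) (T.hZb i) hZ.isNFCurve (S.isNFCurve i) g)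
    T.fn_cofinal hinjS
  -- the point dictionary
  obtain ⟨π, hπiff, hπsurj, hπ⟩ := N.exists_pointDictionary S T h154 h14i hZ hS
  -- representatives
  obtain ⟨i₀⟩ := ‹Nonempty ι›
  have hrepE : ∀ f : (N.NFFunctionField Z)ˣ, ∃ (j : ι) (g : N.regularUnits (S.V j)),
      N.toGeom (T.hZb j) ((N.fieldRes (S.isOpen j)).symm ((g : (N.FunctionField (S.V j))ˣ) : _)) =
        N.nfToGeom Z (f : N.NFFunctionField Z) ∧
      E (Additive.ofMul f) = N.kummerToContainer S j (Additive.ofMul g) := fun f => by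
    obtain ⟨j, -, g, hg⟩ := T.fn_cofinal i₀ (f : N.NFFunctionField Z) f.ne_zero
    exact ⟨j, g, hg, hEpin f j g hg⟩
  -- the orientation sign of law (D)
  rcases Int.units_eq_one_or N.degSign with hs | hs
  · refine ⟨E, π, hEinj, hErange.trans hparts.symm, hπiff, hπsurj, fun f a n => ?_, fun f a => ?_⟩
    · obtain ⟨j, g, hg, hE⟩ := hrepE f
      rw [hE, hπ a, N.hasOrderAt_rep_iff S T h154 h14i h14 h142 hT14 hZ g f hg a n, hs, Units.val_one,
        one_mul, eq_comm]
    · obtain ⟨j, g, hg, hE⟩ := hrepE f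
      rw [hE, hπ a]
      exact N.hasValueOneAt_rep_iff S T h154 h14i h14 h142 hT14 hZ g f hg a
  · refine ⟨-E, π, neg_injective.comp hEinj, ?_, hπiff, hπsurj, fun f a n => ?_, fun f a => ?_⟩
    · rw [← hparts] at hErange
      rw [← hErange]
      ext y
      constructor
      · rintro ⟨x, rfl⟩
        exact ⟨-x, by rw [AddMonoidHom.neg_apply, map_neg]⟩
      · rintro ⟨x, rfl⟩
        exact ⟨-x, by rw [AddMonoidHom.neg_apply, map_neg, neg_neg]⟩
    · obtain ⟨j, g, hg, hE⟩ := hrepE f⁻¹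
      have h1 : (-E) (Additive.ofMul f) = N.kummerToContainer S j (Additive.ofMul g) := by
        rw [AddMonoidHom.neg_apply, ← map_neg, ← ofMul_inv, hE]
      rw [h1, hπ a, N.hasOrderAt_rep_iff S T h154 h14i h14 h142 hT14 hZ g f⁻¹ hg a n, hs,
        Units.val_neg, Units.val_one, Units.val_inv_eq_inv_val,
        PlaceOver.ord_inv _ (Units.ne_zero f), neg_one_mul, neg_neg, eq_comm]
    · obtain ⟨j, g, hg, hE⟩ := hrepE f⁻¹
      have h1 : (-E) (Additive.ofMul f) = N.kummerToContainer S j (Additive.ofMul g) := by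
        rw [AddMonoidHom.neg_apply, ← map_neg, ← ofMul_inv, hE]
      rw [h1, hπ a, N.hasValueOneAt_rep_iff S T h154 h14i h14 h142 hT14 hZ g f⁻¹ hg a]
      exact Subgroup.inv_mem_iff _

/-- **Thm. 1.9 (e) (`Thm19eSat`) for every law-abiding model with saturated tagged systems**: from
abc-iut-L4-t1's named facts `Prop_1_8_i/ii`, `Prop_1_6_iii_units/ker`, `Prop_1_6_i`,
`Prop_1_4_i/i′/ii/ii_transgression` and `Rmk_1_5_4_i` BY NAME, provided every SATURATED directed system
of NF-complements over a (d)-input carries geometric tags (`GeomTags`: its bare homomorphisms are the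
model's open / base-change legs, and it is cofinal).  With `thm19d_of_tags` this puts the whole of Thm.
1.9 (d)(e) at the status "PROVED AT EVERY LAW-ABIDING MODEL for tagged systems, modulo the named facts".
[cite: MochizukiAbsTopIII2015, Thm 1.9 (e) p.38] -/
theorem thm19eSat_of_tags (h18i : N.Prop_1_8_i) (h18ii : N.Prop_1_8_ii) (h16u : N.Prop_1_6_iii_units)
    (h16k : N.Prop_1_6_iii_ker) (h16 : N.Prop_1_6_i) (h154 : Rmk_1_5_4_i.{u}) (h14i : N.Prop_1_4_i)
    (h14 : N.Prop_1_4_i') (h142 : N.Prop_1_4_ii) (hT14 : N.Prop_1_4_ii_transgression)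
    (hT : ∀ (Z : N.Curve), N.IsThm19dInput Z → ∀ (ι : Type u) [Preorder ι] [Nonempty ι]
      [IsDirectedOrder ι] (S : CurveModel.NFComplementSystem N.toCurveModel Z ι), N.IsSaturated S →
      Nonempty (CurveModel.NFComplementSystem.GeomTags N.toDescentKummerModel S)) :
    N.Thm19eSat :=
  N.thm19eSat_of_dictionary fun Z hZ ι _ _ _ S hS => by
    obtain ⟨T⟩ := hT Z hZ ι S hS
    exact N.exists_dictionary S T h18i h18ii h16u h16k h16 h154 h14i h14 h142 hT14 hZ hS

/-- **Thm. 1.9 (e) for every geometric saturated system of every law-abiding model, v2 tower** (the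
statement of record `DescentKummerModel.Thm19eTagged`; NON-VACUOUS: hypotheses = named facts only), from
`Prop_1_8_i/ii`, `Prop_1_6_iii_units/ker`, `Prop_1_6_i`, `Rmk_1_5_4_i`, `Prop_1_4_i/i′/ii/ii_transgression`
BY NAME. [cite: MochizukiAbsTopIII2015, Thm 1.9 (e) p.38] -/
theorem thm19eTagged_of_facts (h18i : N.Prop_1_8_i) (h18ii : N.Prop_1_8_ii)
    (h16u : N.Prop_1_6_iii_units) (h16k : N.Prop_1_6_iii_ker) (h16 : N.Prop_1_6_i)
    (h154 : Rmk_1_5_4_i.{u}) (h14i : N.Prop_1_4_i) (h14 : N.Prop_1_4_i') (h142 : N.Prop_1_4_ii)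
    (hT14 : N.Prop_1_4_ii_transgression) : N.Thm19eTagged := by
  intro Z hZ ι _ _ _ S hS T
  obtain ⟨_, _, hg, e, π, he, hrange, hπ, hπs, hord, hval⟩ :=
    N.exists_dictionary S T h18i h18ii h16u h16k h16 h154 h14i h14 h142 hT14 hZ hS
  obtain ⟨φ, σ, hiso⟩ := N.exists_isIso_evaluationTriple S e he hrange π hπ hπs hord hval
  exact ⟨↥(N.kbarNF Z), N.NFFunctionField Z, inferInstance, inferInstance, inferInstance,
    N.isAlgClosed_kbarNF Z, inferInstance, hg, ⟨RingEquiv.refl _⟩, ⟨RingEquiv.refl _⟩, φ, σ, hiso⟩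

end PlacedKummerModelV2

end Literature.AnabelianGeometry.AbsoluteAnabelian.AbsTopIII
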